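import Mathlib
import Literature.Analysis.FluidPDE.TypeIAncientMild
import Literature.Analysis.FluidPDE.TypeIAncientMildClassical
import Literature.Analysis.FluidPDE.SwirlMaximumPrinciple
import Literature.Analysis.FluidPDE.SpaceTimeCalculus
import Literature.Analysis.FluidPDE.LerayProfileCalculus
import Literature.Analysis.PDE.LoewnerNirenbergKelvin
import Summits.NavierStokesRegularity.NavierStokesRegularity.Theorems.DssFarFieldSlavingBlowupTypeIDssProfileSimilarityEnstrophyTimeOnlyThreshold
import HarnessLib

/-!
# Census block A2 (amplitude meters), in-row members A1pe / A1p0 / A1pw / A1hw / A1bw / A1gw / A1ma / A1ac (instrument «PRESSURE METER») — LINE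
# «pressure-meter» REV 4 port, part 1/6: the instrument `pressureForce` (§A), elementary analysis (§B), the component maximum principle with a pressure force —
# the engine `inner_le_window` (§C, first half)

Re-homed for the scenario census (typer seat ns-census-typer-1 g8; the cells A1pe / A1p0 / A1pw / A1hw / A1bw / A1gw / A1ma / A1ac are MEMBERS OF RECORD «DECIDED IN
KERNEL IN FILES» of block A2 since census v1.73 (critic idea-crit-3 g7 PASS — no price 00:07:29Z on REV 3, RE-STAMP 00:39:59Z on REV 4; ref ns-census-ref g9
PRE-CHECK ✓ §14.22 item 33 / §14.24 item 33′; lead-presearch label); this port makes them TREE-decided): VERBATIM PORT of ns-idea-2 LINE g13-3 «pressure-meter»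
REV 4, `pub/ideators/ns-idea-2/lines/pressure-meter/line-pressure-meter.rev4.lean` sha16 7fb3f23e01caeb0c (1616 l., lean check rc 0, 0 sorry), split for the
400-line rule into `ScenarioCensusPressureMeter` (§A–§C engine) → `…PressureMeterForce` (§C end, §C′ start) → `…PressureMeterWork` (§C′ maximum principle) →
`…PressureMeterHead` (§C″) → `…PressureMeterRows` (§D rows, nestings) → `…PressureMeterCells` (§D holds + census KEYS).  Lean text VERBATIM in namespace
`…Theorems.ScenarioCensus.PressureMeter` (the line's `…Lines.PressureMeter` re-homed); port edits: `local notation "E3"` → `abbrev E3` (typer lint: no notation in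
port files), `@[conjecture]` on the OPEN rows `Row_A1pd` / `Row_A7s` (typed only, ∃-cells), seven one-line docstrings added (gate lint); `tendsto_typeI_bound`
(`C/√(-s) → 0`, twin of a landed tree lemma in a module the farm does not build — gate lint dedup.landed) is not re-declared and its three uses carry the
one-line Mathlib proof inline (proof text only); the line's `set_option maxHeartbeats 400000 in` on the (θ, σ)-engine is kept as filed.  Statements untouched.

No census VALUE is moved here (the members become TREE-decided by name); NS regularity is NOT proved; (L′) ⟨10661⟩ is untouched; no summit statement is
proved by this file.
-/

-- the summit and its single problem share the name `NavierStokesRegularity` (D-0017 nested layout)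
set_option linter.dupNamespace false

noncomputable section

open Set Function Filter Topology Metric

namespace Summit.NavierStokesRegularity.NavierStokesRegularity.Theorems.ScenarioCensus.PressureMeter

open Literature.Analysis Literature.Analysis.FluidPDE InnerProductSpace
open Summit.NavierStokesRegularity.NavierStokesRegularity.Theorems.SimilarityEnstrophy
  (typeI_ancient_eq_zero_of_rate_lt_one)
open scoped Laplacian InnerProductSpace RealInnerProductSpace ContDiff

/-- `ℝ³` (the line's `local notation "E3"`, spelled as a reducible abbreviation for the tree). -/
abbrev E3 := EuclideanSpace ℝ (Fin 3)

/-! ## A. The instrument: the pressure force of a smooth field -/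

/-- The **pressure force** of a smooth space–time field: the residual of the PRESSURELESS (vector
Burgers) operator, `∂ₜu + (u·∇)u − Δu`.  For a classical Navier–Stokes solution (`ν = 1`, no force)
this is `-∇p` (`pressureForce_eq_neg_gradient`); for an element of the Type-I ancient mild class it
is `-∇p` for the KNSS pressure on every window `(t₀, 0)` (`exists_pressure_pressureForce_eq`). -/
def pressureForce (u : ℝ → E3 → E3) (t : ℝ) (x : E3) : E3 :=
  deriv (fun τ => u τ x) t + convect (u t) (u t) x - (Δ (u t)) x

/-- Unfolding `pressureForce`. -/
theorem pressureForce_apply (u : ℝ → E3 → E3) (t : ℝ) (x : E3) :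
    pressureForce u t x = deriv (fun τ => u τ x) t + convect (u t) (u t) x - (Δ (u t)) x := rfl

/-- For a classical solution of the unforced unit-viscosity Navier–Stokes system on an OPEN time
set, the pressure force is `-∇p`. -/
theorem pressureForce_eq_neg_gradient {S : Set ℝ} (hS : IsOpen S) {u : ℝ → E3 → E3}
    {p : ℝ → E3 → ℝ} (hcl : IsClassicalNSSolutionOn S 1 0 u p) {t : ℝ} (ht : t ∈ S) (x : E3) :
    pressureForce u t x = -gradient (p t) x := by
  have h := hcl.momentum t ht x
  rw [timeDerivWithin_eq_deriv hS ht] at h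
  simp only [one_smul, Pi.zero_apply, add_zero] at h
  rw [pressureForce_apply, h]
  abel

/-- For an element of the Type-I ancient mild class and every window `(t₀, 0)`, `t₀ < 0`, there is
a smooth pressure `p` (KNSS 2009 §4: the Riesz-transform pressure; tree
`IsTypeIAncientMild.exists_isClassicalNSSolutionOn_Ioo`) with `(u, p)` classical on the window and
`pressureForce u = -∇p` there.  So every hypothesis below on `pressureForce u` is literally a
hypothesis on the pressure gradient of the model. -/
theorem exists_pressure_pressureForce_eq {C : ℝ} {u : ℝ → E3 → E3} (hu : IsTypeIAncientMild C u)
    {t₀ : ℝ} (ht₀ : t₀ < 0) :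
    ∃ p : ℝ → E3 → ℝ, IsClassicalNSSolutionOn (Ioo t₀ 0) 1 0 u p ∧
      ∀ t ∈ Ioo t₀ 0, ∀ x, pressureForce u t x = -gradient (p t) x := by
  obtain ⟨p, hcl⟩ := hu.exists_isClassicalNSSolutionOn_Ioo ht₀
  exact ⟨p, hcl, fun t ht x => pressureForce_eq_neg_gradient isOpen_Ioo hcl ht x⟩

/-! ## B. Elementary analysis -/

-- `tendsto_typeI_bound`: the Type-I envelope `C/√(-s) → 0` at `-∞` restates a landed tree lemma (gate lint dedup.landed, twin `…Theorems.PolyhedralDssProfileExists.PolyhedralCell.tendsto_typeI_envelope_atBot`, whose module the farm does not build); not re-declared — its uses below carry the one-line Mathlib proof `(Real.tendsto_sqrt_atTop.comp tendsto_neg_atBot_atTop).const_div_atTop C` inline (port edit, proof text only).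

/-- Derivative of `τ ↦ (√(-τ))⁻¹` at `τ < 0`: `1 / (2 (-τ) √(-τ))`. -/
theorem hasDerivAt_inv_sqrt_neg {t : ℝ} (ht : t < 0) :
    HasDerivAt (fun τ : ℝ => (Real.sqrt (-τ))⁻¹) (1 / (2 * ((-t) * Real.sqrt (-t)))) t := by
  have hnt : 0 < -t := neg_pos.2 ht
  have hsq : 0 < Real.sqrt (-t) := Real.sqrt_pos.2 hnt
  have h1 : HasDerivAt (fun τ : ℝ => Real.sqrt (-τ)) (1 / (2 * Real.sqrt (-t)) * (-1)) t := by
    have := (Real.hasDerivAt_sqrt hnt.ne').comp t (hasDerivAt_neg t)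
    simpa [Function.comp_def] using this
  have h2 := h1.inv hsq.ne'
  refine h2.congr_deriv ?_
  have hsq2 : Real.sqrt (-t) ^ 2 = -t := Real.sq_sqrt hnt.le
  rw [hsq2]
  field_simp

/-- Uniform velocity bound on a closed window `[s, T]`, `T < 0`: `‖u(τ, y)‖ ≤ C/√(-T)`. -/
theorem norm_le_window {C : ℝ} {u : ℝ → E3 → E3} (hu : IsTypeIAncientMild C u) {s T : ℝ}
    (hT : T < 0) {τ : ℝ} (hτ : τ ∈ Icc s T) (y : E3) : ‖u τ y‖ ≤ C / Real.sqrt (-T) := by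
  refine (hu.norm_le (lt_of_le_of_lt hτ.2 hT) y).trans ?_
  exact div_le_div_of_nonneg_left hu.nonneg (Real.sqrt_pos.2 (by linarith))
    (Real.sqrt_le_sqrt (by linarith [hτ.2]))

/-! ## C. The component maximum principle with a pressure force (the engine)

For a unit (or shorter) direction `e`, the component `⟪e, u⟫` of a class element satisfies the scalar
advection–diffusion equation `∂ₜ⟪e,u⟫ + u·∇⟪e,u⟫ − Δ⟪e,u⟫ = ⟪e, pressureForce u⟫`.  If the right side is
`≤ η/((-t)√(-t))`, the whole-space weak maximum principle with bounded drift (tree `weak_max_principle`,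
barrier `ε e^{β(t-s)}(1+|x|²)`) compares `⟪e, u⟫` on `[s, T] × ℝ³` with `C/√(-s) + 2η(1/√(-t) − 1/√(-s))`. -/

/-- **Window comparison.**  `⟪e, u(t, x)⟫ ≤ C/√(-s) + 2η (1/√(-t) − 1/√(-s))` for `s ≤ t ≤ T < 0`. -/
theorem inner_le_window {C : ℝ} {u : ℝ → E3 → E3} (hu : IsTypeIAncientMild C u) {e : E3}
    (he : ‖e‖ ≤ 1) {η : ℝ} (hη : 0 ≤ η)
    (hres : ∀ t < 0, ∀ x, ⟪e, pressureForce u t x⟫ ≤ η / ((-t) * Real.sqrt (-t)))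
    {s T : ℝ} (hsT : s < T) (hT : T < 0) :
    ∀ t ∈ Icc s T, ∀ x, ⟪e, u t x⟫ ≤
      C / Real.sqrt (-s) + 2 * η * ((Real.sqrt (-t))⁻¹ - (Real.sqrt (-s))⁻¹) := by
  have hs0 : s < 0 := hsT.trans hT
  -- constants
  set V : ℝ := C / Real.sqrt (-T) with hV
  have hV0 : 0 ≤ V := div_nonneg hu.nonneg (Real.sqrt_nonneg _)
  have hVb : ∀ τ ∈ Icc s T, ∀ y, ‖u τ y‖ ≤ V := fun τ hτ y => norm_le_window hu hT hτ y
  set β : ℝ := V + 7 with hβ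
  have hβ0 : 0 ≤ β := by rw [hβ]; linarith
  set m : ℝ := C / Real.sqrt (-s) with hm
  have hm0 : 0 ≤ m := div_nonneg hu.nonneg (Real.sqrt_nonneg _)
  -- the comparison function `F(t) = 2η (1/√(-t) - 1/√(-s))`
  set F : ℝ → ℝ := fun t => 2 * η * ((Real.sqrt (-t))⁻¹ - (Real.sqrt (-s))⁻¹) with hF
  have hFderiv : ∀ t < 0, HasDerivAt F (η / ((-t) * Real.sqrt (-t))) t := by
    intro t ht
    have h := ((hasDerivAt_inv_sqrt_neg ht).sub_const ((Real.sqrt (-s))⁻¹)).const_mul (2 * η)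
    refine h.congr_deriv ?_
    have hnt : 0 < -t := neg_pos.2 ht
    have hsq : 0 < Real.sqrt (-t) := Real.sqrt_pos.2 hnt
    have hne : (-t) * Real.sqrt (-t) ≠ 0 := by positivity
    field_simp
  have hFnonneg : ∀ t ∈ Icc s T, 0 ≤ F t := by
    intro t ht
    have ht0 : t < 0 := lt_of_le_of_lt ht.2 hT
    have h1 : Real.sqrt (-t) ≤ Real.sqrt (-s) := Real.sqrt_le_sqrt (by linarith [ht.1])
    have h2 : 0 < Real.sqrt (-t) := Real.sqrt_pos.2 (by linarith)
    have h3 : (Real.sqrt (-s))⁻¹ ≤ (Real.sqrt (-t))⁻¹ := inv_anti₀ h2 h1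
    have : 0 ≤ (Real.sqrt (-t))⁻¹ - (Real.sqrt (-s))⁻¹ := sub_nonneg.2 h3
    positivity
  have hFs : F s = 0 := by simp [hF]
  -- smoothness data of the class
  have hsm : IsSmoothSpaceTimeOn (Iio 0) u := hu.1
  have huC2 : ∀ t < 0, ContDiff ℝ 2 (u t) := fun t ht =>
    (hu.contDiff_slice ht).of_le (by norm_cast)
  have hud : ∀ t < 0, ∀ x, DifferentiableAt ℝ (u t) x := fun t ht x =>
    ((huC2 t ht).of_le one_le_two).differentiable one_ne_zero x
  have hut : ∀ t < 0, ∀ x, HasDerivAt (fun τ => u τ x) (deriv (fun τ => u τ x) t) t := by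
    intro t ht x
    exact ((hsm.differentiableWithinAt_time (mem_Iio.2 ht) x).differentiableAt
      (Iio_mem_nhds ht)).hasDerivAt
  -- the claim for every `ε > 0`, on every large ball
  suffices key : ∀ ε : ℝ, 0 < ε → ∀ R : ℝ, V / ε ≤ R →
      ∀ t ∈ Icc s T, ∀ x ∈ closedBall (0 : E3) R,
        ⟪e, u t x⟫ - ((m + F t) + ε * Real.exp (β * (t - s)) * (1 + ‖x‖ ^ 2)) ≤ 0 by
    intro t ht x
    refine le_of_forall_pos_le_add fun δ hδ => ?_
    set A : ℝ := Real.exp (β * (t - s)) * (1 + ‖x‖ ^ 2) with hA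
    have hApos : 0 < A := by positivity
    have h := key (δ / A) (div_pos hδ hApos) (max (V / (δ / A)) ‖x‖) (le_max_left _ _) t ht x
      (mem_closedBall_zero_iff.2 (le_max_right _ _))
    have e1 : δ / A * Real.exp (β * (t - s)) * (1 + ‖x‖ ^ 2) = δ := by
      rw [hA]; field_simp
    rw [e1] at h
    simp only [hm, hF] at h ⊢
    linarith
  intro ε hε R hR
  have hR0 : 0 ≤ R := le_trans (div_nonneg hV0 hε.le) hR
  -- the comparison function and its time derivative
  set w : ℝ → E3 → ℝ := fun t x =>
    ⟪e, u t x⟫ - ((m + F t) + ε * Real.exp (β * (t - s)) * (1 + ‖x‖ ^ 2)) with hw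
  set wₜ : ℝ → E3 → ℝ := fun t x =>
    ⟪e, deriv (fun τ => u τ x) t⟫ -
      (η / ((-t) * Real.sqrt (-t)) + β * (ε * Real.exp (β * (t - s)) * (1 + ‖x‖ ^ 2))) with hwₜ
  set K : Set E3 := closedBall 0 R with hK
  set U : Set E3 := ball 0 R with hU
  have hKc : IsCompact K := isCompact_closedBall _ _
  have hUo : IsOpen U := isOpen_ball
  have hUK : U ⊆ K := ball_subset_closedBall
  -- (a) joint continuity on `[s, T] × K`
  have hc : ContinuousOn (uncurry w) (Icc s T ×ˢ K) := by
    have hsub : Icc s T ×ˢ K ⊆ Iio (0 : ℝ) ×ˢ (univ : Set E3) :=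
      prod_mono (fun t ht => lt_of_le_of_lt ht.2 hT) (subset_univ _)
    have huc : ContinuousOn (uncurry u) (Icc s T ×ˢ K) := hsm.continuousOn.mono hsub
    have h1 : ContinuousOn (fun p : ℝ × E3 => ⟪e, uncurry u p⟫) (Icc s T ×ˢ K) :=
      continuousOn_const.inner huc
    have hsqrt : ContinuousOn (fun p : ℝ × E3 => (Real.sqrt (-p.1))⁻¹) (Icc s T ×ˢ K) := by
      refine ContinuousOn.inv₀ (by fun_prop) ?_
      intro p hp
      have : p.1 < 0 := lt_of_le_of_lt hp.1.2 hT
      exact (Real.sqrt_pos.2 (by linarith)).ne'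
    have h2 : ContinuousOn (fun p : ℝ × E3 =>
        (m + 2 * η * ((Real.sqrt (-p.1))⁻¹ - (Real.sqrt (-s))⁻¹)) +
          ε * Real.exp (β * (p.1 - s)) * (1 + ‖p.2‖ ^ 2)) (Icc s T ×ˢ K) := by
      have h3 : ContinuousOn (fun p : ℝ × E3 => ε * Real.exp (β * (p.1 - s)) * (1 + ‖p.2‖ ^ 2))
          (Icc s T ×ˢ K) := by fun_prop
      exact (continuousOn_const.add (continuousOn_const.mul (hsqrt.sub continuousOn_const))).add h3
    refine (h1.sub h2).congr fun p _ => ?_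
    simp only [hw, hF, uncurry, Pi.sub_apply]
  -- (b) smooth slices
  have h2 : ∀ t ∈ Ioc s T, ContDiff ℝ 2 (w t) := by
    intro t ht
    have ht0 : t < 0 := lt_of_le_of_lt ht.2 hT
    exact (contDiff_const.inner ℝ (huC2 t ht0)).sub
      (contDiff_barrier (m + F t) (ε * Real.exp (β * (t - s))))
  -- (c) the left time derivative
  have ht : ∀ t ∈ Ioc s T, ∀ x ∈ U, HasDerivWithinAt (fun τ => w τ x) (wₜ t x) (Icc s t) t := by
    intro t ht x _
    have ht0 : t < 0 := lt_of_le_of_lt ht.2 hT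
    have h_in : HasDerivAt (fun τ => ⟪e, u τ x⟫) ⟪e, deriv (fun τ => u τ x) t⟫ t := by
      have h := (hasDerivAt_const t e).inner ℝ (hut t ht0 x)
      simpa using h
    have h_exp : HasDerivAt (fun τ => ε * Real.exp (β * (τ - s)) * (1 + ‖x‖ ^ 2))
        (β * (ε * Real.exp (β * (t - s)) * (1 + ‖x‖ ^ 2))) t := by
      have h1 : HasDerivAt (fun τ => Real.exp (β * (τ - s))) (Real.exp (β * (t - s)) * β) t := by
        have := (((hasDerivAt_id t).sub_const s).const_mul β).exp
        simpa using this
      have h2 := (h1.const_mul ε).mul_const (1 + ‖x‖ ^ 2)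
      refine h2.congr_deriv ?_
      ring
    have h_all := h_in.sub (((hFderiv t ht0).const_add m).add h_exp)
    simp only [hw, hwₜ]
    exact h_all.hasDerivWithinAt
  -- (d) the sub-solution implication, from the residual inequality
  have hsub : ∀ t ∈ Ioc s T, ∀ x ∈ U, fderiv ℝ (w t) x = 0 → (Δ (w t)) x ≤ 0 → wₜ t x ≤ 0 := by
    intro t ht x hx hgrad hlap
    have ht0 : t < 0 := lt_of_le_of_lt ht.2 hT
    have htI : t ∈ Icc s T := ⟨ht.1.le, ht.2⟩
    set c : ℝ := ε * Real.exp (β * (t - s)) with hc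
    have hc0 : 0 < c := by positivity
    -- derivative of `w t`
    have hB := hasFDerivAt_barrier (m + F t) c x
    have hI : HasFDerivAt (fun y => ⟪e, u t y⟫)
        ((innerSL ℝ e : E3 →L[ℝ] ℝ).comp (fderiv ℝ (u t) x)) x := by
      have h := (innerSL ℝ e : E3 →L[ℝ] ℝ).hasFDerivAt.comp x (hud t ht0 x).hasFDerivAt
      have hfun : (fun y => ⟪e, u t y⟫) = (innerSL ℝ e : E3 →L[ℝ] ℝ) ∘ u t := by
        funext y; simp
      rw [hfun]
      exact h
    have hwderiv : HasFDerivAt (w t) ((innerSL ℝ e : E3 →L[ℝ] ℝ).comp (fderiv ℝ (u t) x) -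
        c • ((2 : ℕ) • (innerSL ℝ x : E3 →L[ℝ] ℝ))) x := by
      have h := hI.sub hB
      simp only [hw, hc]
      exact h
    have hDeq : (innerSL ℝ e : E3 →L[ℝ] ℝ).comp (fderiv ℝ (u t) x) =
        c • ((2 : ℕ) • (innerSL ℝ x : E3 →L[ℝ] ℝ)) := by
      have := hwderiv.fderiv
      rw [hgrad] at this
      exact (sub_eq_zero.1 this.symm)
    have hDapply : ∀ a : E3, ⟪e, fderiv ℝ (u t) x a⟫ = c * (2 * ⟪x, a⟫) := fun a => by
      have := congrArg (fun L : E3 →L[ℝ] ℝ => L a) hDeq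
      simpa [innerSL_apply_apply, nsmul_eq_mul] using this
    -- Laplacians
    have hΔeq : (Δ (w t)) x = ⟪e, (Δ (u t)) x⟫ - 6 * c := by
      have h1 : ContDiffAt ℝ 2 (fun y => ⟪e, u t y⟫) x :=
        (contDiff_const.inner ℝ (huC2 t ht0)).contDiffAt
      have h2' : ContDiffAt ℝ 2 (fun y : E3 => ((m + F t) + c * (1 + ‖y‖ ^ 2) : ℝ)) x :=
        (contDiff_barrier (m + F t) c).contDiffAt
      have h3 : (Δ (fun y => ⟪e, u t y⟫)) x = ⟪e, (Δ (u t)) x⟫ := by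
        have hfun : (fun y => ⟪e, u t y⟫) = (innerSL ℝ e : E3 →L[ℝ] ℝ) ∘ u t := by
          funext y; simp
        rw [hfun, (huC2 t ht0).contDiffAt.laplacian_CLM_comp_left, Function.comp_apply,
          innerSL_apply_apply]
      have h4 := h1.laplacian_sub h2'
      have hfun : w t = (fun y => ⟪e, u t y⟫) -
          fun y : E3 => ((m + F t) + c * (1 + ‖y‖ ^ 2) : ℝ) := by
        funext y
        simp only [hw, hc, Pi.sub_apply]
      rw [hfun, h4, h3, laplacian_barrier]
    have hΔ : ⟪e, (Δ (u t)) x⟫ ≤ 6 * c := by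
      rw [hΔeq] at hlap; linarith
    -- the residual inequality at `(t, x)`
    have hr := hres t ht0 x
    rw [pressureForce_apply, inner_sub_right, inner_add_right, convect_apply, hDapply (u t x)] at hr
    -- the drift term at the critical point
    have hconv : -(c * (2 * ⟪x, u t x⟫)) ≤ c * (2 * (‖x‖ * V)) := by
      have h1 : |⟪x, u t x⟫| ≤ ‖x‖ * ‖u t x‖ := abs_real_inner_le_norm _ _
      have h2 : ‖x‖ * ‖u t x‖ ≤ ‖x‖ * V :=
        mul_le_mul_of_nonneg_left (hVb t htI x) (norm_nonneg _)
      have h3 := (abs_le.1 (h1.trans h2)).1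
      nlinarith
    -- conclude
    set A : ℝ := c * (1 + ‖x‖ ^ 2) with hA
    have hA0 : 0 ≤ A := by positivity
    have hx2 : 2 * (‖x‖ * V) ≤ V * (1 + ‖x‖ ^ 2) := by
      nlinarith [sq_nonneg (‖x‖ - 1), norm_nonneg x]
    have hx2' : c * (2 * (‖x‖ * V)) ≤ V * A := by
      calc c * (2 * (‖x‖ * V)) ≤ c * (V * (1 + ‖x‖ ^ 2)) := mul_le_mul_of_nonneg_left hx2 hc0.le
        _ = V * A := by rw [hA]; ring
    have h6 : 6 * c ≤ 7 * A := by
      have hpos : 0 ≤ c * ‖x‖ ^ 2 := by positivity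
      have e1 : 7 * A - 6 * c = c + 7 * (c * ‖x‖ ^ 2) := by rw [hA]; ring
      nlinarith
    have e2 : β * A = V * A + 7 * A := by rw [hβ]; ring
    have e3 : wₜ t x = ⟪e, deriv (fun τ => u τ x) t⟫ - (η / ((-t) * Real.sqrt (-t)) + β * A) := by
      simp only [hwₜ, hA, hc]
    rw [e3]
    linarith
  -- (e) the parabolic boundary: `t = s`
  have hbot : ∀ x ∈ K, w s x ≤ 0 := by
    intro x _
    have h1 : ⟪e, u s x⟫ ≤ m := by
      calc ⟪e, u s x⟫ ≤ ‖e‖ * ‖u s x‖ := real_inner_le_norm _ _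
        _ ≤ 1 * ‖u s x‖ := mul_le_mul_of_nonneg_right he (norm_nonneg _)
        _ ≤ m := by rw [one_mul, hm]; exact hu.norm_le hs0 x
    have h3 : 0 ≤ ε * Real.exp (β * (s - s)) * (1 + ‖x‖ ^ 2) := by positivity
    simp only [hw]
    rw [hFs]
    linarith
  -- (f) the parabolic boundary: the sphere `|x| = R`
  have hlat : ∀ t ∈ Icc s T, ∀ x ∈ K \ U, w t x ≤ 0 := by
    intro t ht' x hx
    have hxK : ‖x‖ ≤ R := mem_closedBall_zero_iff.1 hx.1
    have hxR : ‖x‖ = R := by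
      have hnot : x ∉ ball (0 : E3) R := hx.2
      have : R ≤ ‖x‖ := by simpa using hnot
      exact le_antisymm hxK this
    have hexp1 : 1 ≤ Real.exp (β * (t - s)) :=
      Real.one_le_exp (mul_nonneg hβ0 (by linarith [ht'.1]))
    have hH : ε * (1 + ‖x‖ ^ 2) ≤ ε * Real.exp (β * (t - s)) * (1 + ‖x‖ ^ 2) := by
      have : ε * (1 + ‖x‖ ^ 2) * 1 ≤ ε * (1 + ‖x‖ ^ 2) * Real.exp (β * (t - s)) :=
        mul_le_mul_of_nonneg_left hexp1 (by positivity)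
      linarith
    have h1 : ⟪e, u t x⟫ ≤ V := by
      calc ⟪e, u t x⟫ ≤ ‖e‖ * ‖u t x‖ := real_inner_le_norm _ _
        _ ≤ 1 * ‖u t x‖ := mul_le_mul_of_nonneg_right he (norm_nonneg _)
        _ ≤ V := by rw [one_mul]; exact hVb t ht' x
    have h2 : V ≤ ε * (1 + ‖x‖ ^ 2) := by
      rw [hxR]
      have hεR : V ≤ ε * R := by rwa [div_le_iff₀' hε] at hR
      nlinarith [sq_nonneg (R - 1), hε.le]
    have hF0 := hFnonneg t ht'
    simp only [hw]
    linarith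
  intro t ht' x hx
  have h := weak_max_principle hKc hUo hUK hc h2 ht hsub hbot hlat t ht' x hx
  simpa only [hw] using h

end Summit.NavierStokesRegularity.NavierStokesRegularity.Theorems.ScenarioCensus.PressureMeter

end
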